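import Literature.Probability.LatticeModels.PlaneRotatorMeanFieldBound
import HarnessLib

/-!
# The equipartition identity for plane rotators and the local energy bound
# `∑_{a ∋ x} J_a ⟨cos(∇θ)_a⟩_J ≤ 2S_x²/(1 + 2S_x)`, `S_x = ∑_{a ∋ x} J_a`

Topic `Literature/Probability/LatticeModels`. For the plane rotator (classical XY model) with general
ferromagnetic bond couplings `J_a ≥ 0` on a finite bond system `G : BondSystem V ι` (Gibbs weight
`w_J = exp(∑_a J_a cos(θ_{tgt a} − θ_{src a}))` on `U(1)^V`, Haar probability measure), rotating the
single spin at `x` is a one-parameter subgroup of the torus along which every bond character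
`χ_a(θ) = θ̄_{src a} θ_{tgt a}` is an exponential `e^{ik_a s}` with the **site charge**
`k_a = [tgt a = x] − [src a = x] ∈ {−1, 0, 1}` (`siteCharge`). The tree's local Ward identity of
Aizenman–Simon for Ginibre models (`Literature.Probability.LatticeModels.ginibre_localWard`,
`PlaneRotatorMeanFieldBound.lean`; M. Aizenman, B. Simon, *Local Ward identities and the decay of
correlations in ferromagnets*, Comm. Math. Phys. **77** (1980) 137–143, eq. (2.4)
[AizenmanSimon1980LocalWard]) — i.e. the integration by parts `∫ ∂_x(F w_J) dθ = 0` — applied to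
`F = ∂_x(∑_a J_a cos(∇θ)_a)` and summed over the bonds at `x` gives the **equipartition identity**

  `∑_a J_a k_a² ⟨cos(θ_{tgt a} − θ_{src a})⟩_J = ⟨(∑_a J_a k_a sin(θ_{tgt a} − θ_{src a}))²⟩_J`     (E)

(`sum_siteCharge_sq_energy_eq`, stated with the un-normalised integrals) — the classical
virial/equipartition theorem `⟨∂²_x H⟩ = ⟨(∂_x H)²⟩` for the angle `θ_x` (folklore; e.g. the `N = 2`
case of Aizenman–Simon's (2.4) with `A = ∂_x H`). With the weighted Cauchy–Schwarz inequality and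
`sin² = 1 − cos² ≤ 2(1 − cos)` it yields, for `J ≥ 0`, the **local energy bound**

  `e_x ≤ 2 S_x² / (1 + 2 S_x)`,  `e_x := ∑_a J_a k_a² ⟨cos(∇θ)_a⟩_J`,  `S_x := ∑_a J_a k_a²`   (B)

(`siteEnergy_le`): the coupling-weighted energy of the bonds at any site stays a definite amount
below its maximum `S_x` at every finite coupling — the rigorous half of the equipartition law
`J(1 − ⟨cos ∇θ⟩) ≈ T/4` of the two-dimensional XY model (for the nearest-neighbour torus at coupling
`K`, `S_x = 4K` and (B) reads `⟨cos(∇θ)⟩ ≤ 8K/(1 + 8K)`, sequel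
`PlaneRotatorEnergyRenormalizedDecay.lean`).

Use (cell `pub/hubbard-tc`, START-HERE §6 crux №2, classical half): (B) is the input that makes the
energy-weighted McBryan–Spencer bound of `PlaneRotatorJensenRotationBound.lean` strictly stronger than
the bare one; it is the classical counterpart of a certified thermal kinetic-energy ceiling strictly
below the kinematic maximum.

## References

* M. Aizenman, B. Simon, Comm. Math. Phys. 77 (1980) 137–143, eq. (2.4) (local Ward identity).
  [AizenmanSimon1980LocalWard]
* J. Ginibre, Comm. Math. Phys. 16 (1970) 310–328, Example 4 (the model; Griffiths' first inequality
  `⟨cos⟩ ≥ 0` is NOT used here). [Ginibre1970]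

Tree: `ginibre_localWard`, `PlaneRotator.rot`, `PlaneRotator.rotWeight`, `BondSystem.bondChar`;
Mathlib: `Finset.sum_mul_sq_le_sq_mul_sq`. All statements are about the un-normalised integrals
`∫ Re χ_a w_J` or the Ginibre expectations `ginibreExpect (torusHaar V) G.bondChar J`.
-/

noncomputable section

open MeasureTheory Finset
open scoped BigOperators

namespace Literature.Probability.LatticeModels

namespace BondSystem

variable {V ι : Type*} (G : BondSystem V ι)

/-! ### Site charges of the bond characters -/

section Charges

variable [DecidableEq V]

/-- The **site charge** of the bond `a` at the site `x`: `k_a(x) = [tgt a = x] − [src a = x]`, the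
frequency of the bond character `θ̄_{src a} θ_{tgt a}` under the rotation of the single spin `x`
(`PlaneRotator.rotWeight`). [cite: AizenmanSimon1980LocalWard, eq. (2.4) (rotation of one spin)] -/
def siteCharge (x : V) (a : ι) : ℝ :=
  PlaneRotator.rotWeight x (G.src a, G.tgt a)

/-- `k_a(x) = [tgt a = x] − [src a = x]`. [cite: AizenmanSimon1980LocalWard, eq. (2.4) (rotation of one spin)] -/
theorem siteCharge_eq (x : V) (a : ι) :
    G.siteCharge x a = (if G.tgt a = x then 1 else 0) - (if G.src a = x then 1 else 0) := rfl

/-- The site charge is `−1`, `0` or `1`. [cite: AizenmanSimon1980LocalWard, eq. (2.4) (rotation of one spin)] -/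
theorem siteCharge_mem (x : V) (a : ι) :
    G.siteCharge x a = -1 ∨ G.siteCharge x a = 0 ∨ G.siteCharge x a = 1 := by
  rw [siteCharge_eq]
  by_cases h1 : G.tgt a = x <;> by_cases h2 : G.src a = x <;> simp [h1, h2]

/-- `k³ = k` for a site charge. [cite: AizenmanSimon1980LocalWard, eq. (2.4) (rotation of one spin)] -/
theorem siteCharge_sq_mul_self (x : V) (a : ι) :
    G.siteCharge x a ^ 2 * G.siteCharge x a = G.siteCharge x a := by
  rcases G.siteCharge_mem x a with h | h | h <;> rw [h] <;> norm_num

/-- `k⁴ = k²` for a site charge. [cite: AizenmanSimon1980LocalWard, eq. (2.4) (rotation of one spin)] -/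
theorem siteCharge_sq_mul_sq (x : V) (a : ι) :
    G.siteCharge x a ^ 2 * G.siteCharge x a ^ 2 = G.siteCharge x a ^ 2 := by
  rcases G.siteCharge_mem x a with h | h | h <;> rw [h] <;> norm_num

/-- `0 ≤ k² ≤ 1`. [cite: AizenmanSimon1980LocalWard, eq. (2.4) (rotation of one spin)] -/
theorem siteCharge_sq_le_one (x : V) (a : ι) : G.siteCharge x a ^ 2 ≤ 1 := by
  rcases G.siteCharge_mem x a with h | h | h <;> rw [h] <;> norm_num

/-- Along the rotation of the spin `x`, the bond character `a` is the exponential `e^{i k_a(x) s}`.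
[cite: AizenmanSimon1980LocalWard, eq. (2.4) (rotation of one spin)] -/
theorem bondChar_rot (x : V) (a : ι) (s : ℝ) :
    G.bondChar a (PlaneRotator.rot x s) = Circle.exp (G.siteCharge x a * s) := by
  unfold PlaneRotator.rot siteCharge PlaneRotator.rotWeight bondChar
  rw [diffChar_apply]
  by_cases hx : G.src a = x <;> by_cases hy : G.tgt a = x
  · subst hx; rw [hy]; simp
  · subst hx; simp [hy, ← Circle.exp_neg]
  · subst hy; simp [hx]
  · simp [hx, hy]

end Charges

/-! ### Pointwise algebra: local coupling sum and Cauchy–Schwarz -/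

section Pointwise

variable [Fintype ι] [DecidableEq V]

omit [DecidableEq V] in
/-- `Re χ² + Im χ² = 1` for a unitary character. [folklore] -/
private theorem reChar_sq_add_imChar_sq (χ : (V → Circle) →ₜ* Circle) (θ : V → Circle) :
    reChar χ θ ^ 2 + imChar χ θ ^ 2 = 1 := by
  have h := Circle.normSq_coe (χ θ)
  rw [Complex.normSq_apply] at h
  rw [reChar, imChar]
  nlinarith [h]

/-- The **local coupling sum** `S_x = ∑_a J_a k_a(x)²` (the total coupling of the bonds with exactly
one endpoint at `x`). [cite: AizenmanSimon1980LocalWard, Thm 3.1 (local coupling sum ∑_y J_{xy})] -/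
def siteCouplingSum (J : ι → ℝ) (x : V) : ℝ :=
  ∑ a, J a * G.siteCharge x a ^ 2

/-- `S_x ≥ 0` for `J ≥ 0`. [cite: AizenmanSimon1980LocalWard, Thm 3.1 (local coupling sum ∑_y J_{xy})] -/
theorem siteCouplingSum_nonneg {J : ι → ℝ} (hJ : ∀ a, 0 ≤ J a) (x : V) : 0 ≤ G.siteCouplingSum J x :=
  Finset.sum_nonneg fun a _ => mul_nonneg (hJ a) (sq_nonneg _)

/-- Pointwise: `(∑_a J_a k_a Im χ_a)² ≤ S_x · ∑_a J_a k_a² (Im χ_a)²` (weighted Cauchy–Schwarz, `k³ = k`,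
`k⁴ = k²`). [cite: AizenmanSimon1980LocalWard, eq. (2.4) with A = ∂H/∂θ_x (N = 2)] -/
theorem sq_sum_siteCharge_imChar_le {J : ι → ℝ} (hJ : ∀ a, 0 ≤ J a) (x : V) (θ : V → Circle) :
    (∑ a, J a * G.siteCharge x a * imChar (G.bondChar a) θ) ^ 2 ≤
      G.siteCouplingSum J x * ∑ a, J a * G.siteCharge x a ^ 2 * imChar (G.bondChar a) θ ^ 2 := by
  set f : ι → ℝ := fun a => Real.sqrt (J a * G.siteCharge x a ^ 2) with hf
  set g : ι → ℝ := fun a => Real.sqrt (J a * G.siteCharge x a ^ 2) *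
    (G.siteCharge x a * imChar (G.bondChar a) θ) with hg
  have hnn : ∀ a, 0 ≤ J a * G.siteCharge x a ^ 2 := fun a => mul_nonneg (hJ a) (sq_nonneg _)
  have hfg : ∀ a, f a * g a = J a * G.siteCharge x a * imChar (G.bondChar a) θ := by
    intro a
    simp only [hf, hg]
    rw [← mul_assoc, Real.mul_self_sqrt (hnn a), mul_assoc (J a), ← mul_assoc (G.siteCharge x a ^ 2),
      siteCharge_sq_mul_self, mul_assoc]
  have hff : ∀ a, f a ^ 2 = J a * G.siteCharge x a ^ 2 := fun a => by
    simp only [hf]; rw [sq, Real.mul_self_sqrt (hnn a)]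
  have hgg : ∀ a, g a ^ 2 = J a * G.siteCharge x a ^ 2 * imChar (G.bondChar a) θ ^ 2 := by
    intro a
    simp only [hg]
    rw [mul_pow, sq (Real.sqrt _), Real.mul_self_sqrt (hnn a), mul_pow, ← mul_assoc, mul_assoc (J a),
      siteCharge_sq_mul_sq]
  have h := Finset.sum_mul_sq_le_sq_mul_sq univ f g
  simp only [hfg, hff, hgg] at h
  exact h

end Pointwise

/-! ### The equipartition identity -/

section Equipartition

variable [Fintype V] [Fintype ι] [DecidableEq V] [MeasurableSpace Circle] [BorelSpace Circle]

/-- **The equipartition identity** (integration by parts in the angle `θ_x`, i.e. the local Ward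
identity `ginibre_localWard` with `χ₀ = χ_b`, weighted by `J_b k_b` and summed over `b`): for every
finite bond system, all real couplings `J`, every site `x`,
`∑_a J_a k_a(x)² ∫ Re χ_a · w_J = ∫ (∑_a J_a k_a(x) Im χ_a)² · w_J`, i.e.
`∑_{a ∋ x} J_a ⟨cos(∇θ)_a⟩_J = ⟨(∑_a J_a k_a sin(∇θ)_a)²⟩_J` (`⟨∂²_x H⟩ = ⟨(∂_x H)²⟩`).
[cite: AizenmanSimon1980LocalWard, eq. (2.4) with A = ∂H/∂θ_x (N = 2)] -/
theorem sum_siteCharge_sq_energy_eq (J : ι → ℝ) (x : V) :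
    ∑ a, J a * G.siteCharge x a ^ 2 *
        ∫ θ, reChar (G.bondChar a) θ * ginibreWeight G.bondChar J θ ∂torusHaar V =
      ∫ θ, (∑ a, J a * G.siteCharge x a * imChar (G.bondChar a) θ) ^ 2 *
        ginibreWeight G.bondChar J θ ∂torusHaar V := by
  set w : (V → Circle) → ℝ := ginibreWeight G.bondChar J with hw
  have hwc : Continuous w := continuous_ginibreWeight _ _
  -- the local Ward identity for each bond character
  have hW : ∀ b, G.siteCharge x b * ∫ θ, reChar (G.bondChar b) θ * w θ ∂torusHaar V =
      ∑ a, J a * G.siteCharge x a *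
        ∫ θ, imChar (G.bondChar b) θ * imChar (G.bondChar a) θ * w θ ∂torusHaar V := fun b =>
    ginibre_localWard (torusHaar V) G.bondChar J (G.bondChar b) (u := PlaneRotator.rot x)
      (fun s => G.bondChar_rot x b s) (fun a s => G.bondChar_rot x a s)
  -- weight by `J_b k_b` and sum
  have hlhs : ∑ b, J b * G.siteCharge x b ^ 2 * ∫ θ, reChar (G.bondChar b) θ * w θ ∂torusHaar V =
      ∑ b, ∑ a, (J b * G.siteCharge x b) * (J a * G.siteCharge x a) *
        ∫ θ, imChar (G.bondChar b) θ * imChar (G.bondChar a) θ * w θ ∂torusHaar V := by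
    refine Finset.sum_congr rfl fun b _ => ?_
    rw [show J b * G.siteCharge x b ^ 2 * ∫ θ, reChar (G.bondChar b) θ * w θ ∂torusHaar V =
        (J b * G.siteCharge x b) * (G.siteCharge x b * ∫ θ, reChar (G.bondChar b) θ * w θ ∂torusHaar V)
        by ring, hW b, Finset.mul_sum]
    exact Finset.sum_congr rfl fun a _ => by ring
  rw [hlhs]
  -- the square of the sum, integrated termwise
  have hi : ∀ b a, Integrable (fun θ => (J b * G.siteCharge x b) * (J a * G.siteCharge x a) *
      (imChar (G.bondChar b) θ * imChar (G.bondChar a) θ * w θ)) (torusHaar V) := fun b a =>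
    integrable_torusHaar_of_continuous (continuous_const.mul
      (((continuous_imChar _).mul (continuous_imChar _)).mul hwc))
  have hsq : ∀ θ, (∑ a, J a * G.siteCharge x a * imChar (G.bondChar a) θ) ^ 2 * w θ =
      ∑ b, ∑ a, (J b * G.siteCharge x b) * (J a * G.siteCharge x a) *
        (imChar (G.bondChar b) θ * imChar (G.bondChar a) θ * w θ) := by
    intro θ
    rw [sq, Finset.sum_mul_sum, Finset.sum_mul]
    refine Finset.sum_congr rfl fun b _ => ?_
    rw [Finset.sum_mul]
    exact Finset.sum_congr rfl fun a _ => by ring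
  simp_rw [hsq]
  rw [integral_finsetSum _ fun b _ => integrable_finsetSum _ fun a _ => hi b a]
  refine Finset.sum_congr rfl fun b _ => ?_
  rw [integral_finsetSum _ fun a _ => hi b a]
  refine Finset.sum_congr rfl fun a _ => ?_
  rw [integral_const_mul]

/-! ### The local energy bound -/

/-- The **local energy** `e_x = ∑_a J_a k_a(x)² ⟨cos(θ_{tgt a} − θ_{src a})⟩_J` at the site `x`
(coupling-weighted sum of the energies of the bonds at `x`). [cite: AizenmanSimon1980LocalWard, eq. (2.4) with A = ∂H/∂θ_x (N = 2)] -/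
def siteEnergy (J : ι → ℝ) (x : V) : ℝ :=
  ∑ a, J a * G.siteCharge x a ^ 2 * ginibreExpect (torusHaar V) G.bondChar J (reChar (G.bondChar a))

/-- **The local energy bound.** For every finite bond system with ferromagnetic couplings `J ≥ 0`
and every site `x`: `e_x ≤ 2 S_x² / (1 + 2 S_x)`, where `e_x = ∑_a J_a k_a(x)² ⟨cos(∇θ)_a⟩_J` is the
coupling-weighted energy of the bonds at `x` and `S_x = ∑_a J_a k_a(x)²` its maximum (equipartition
identity, Cauchy–Schwarz, `sin² ≤ 2(1 − cos)`). In particular `e_x < S_x` unless `S_x = 0`.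
[cite: AizenmanSimon1980LocalWard, eq. (2.4) with A = ∂H/∂θ_x (N = 2)] -/
theorem siteEnergy_le {J : ι → ℝ} (hJ : ∀ a, 0 ≤ J a) (x : V) :
    G.siteEnergy J x ≤ 2 * G.siteCouplingSum J x ^ 2 / (1 + 2 * G.siteCouplingSum J x) := by
  set w : (V → Circle) → ℝ := ginibreWeight G.bondChar J with hw
  set Z : ℝ := ∫ θ, w θ ∂torusHaar V with hZdef
  set S : ℝ := G.siteCouplingSum J x with hSdef
  have hwc : Continuous w := continuous_ginibreWeight _ _
  have hwpos : ∀ θ, 0 < w θ := fun θ => Real.exp_pos _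
  have hZ : 0 < Z := integral_exp_pos (integrable_torusHaar_of_continuous hwc)
  have hS : 0 ≤ S := G.siteCouplingSum_nonneg hJ x
  -- `e_x · Z = ∑ J k² ∫ Re w`
  set E : ℝ := ∑ a, J a * G.siteCharge x a ^ 2 * ∫ θ, reChar (G.bondChar a) θ * w θ ∂torusHaar V with hEdef
  have hE : G.siteEnergy J x * Z = E := by
    rw [siteEnergy, Finset.sum_mul]
    refine Finset.sum_congr rfl fun a _ => ?_
    rw [ginibreExpect, mul_assoc, div_mul_cancel₀ _ hZ.ne']
  -- integrability facts
  have hi1 : ∀ a, Integrable (fun θ => reChar (G.bondChar a) θ * w θ) (torusHaar V) := fun a =>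
    integrable_torusHaar_of_continuous ((continuous_reChar _).mul hwc)
  have hi2 : Integrable (fun θ => (∑ a, J a * G.siteCharge x a ^ 2 * imChar (G.bondChar a) θ ^ 2) * w θ)
      (torusHaar V) :=
    integrable_torusHaar_of_continuous ((continuous_finsetSum _ fun a _ =>
      continuous_const.mul ((continuous_imChar _).pow 2)).mul hwc)
  have hi3 : Integrable (fun θ => (∑ a, J a * G.siteCharge x a * imChar (G.bondChar a) θ) ^ 2 * w θ)
      (torusHaar V) :=
    integrable_torusHaar_of_continuous (((continuous_finsetSum _ fun a _ =>
      continuous_const.mul (continuous_imChar _)).pow 2).mul hwc)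
  -- Step 1: equipartition + Cauchy–Schwarz: `E ≤ S ∫ (∑ J k² Im²) w`
  have h1 : E ≤ S * ∫ θ, (∑ a, J a * G.siteCharge x a ^ 2 * imChar (G.bondChar a) θ ^ 2) * w θ
      ∂torusHaar V := by
    rw [hEdef, G.sum_siteCharge_sq_energy_eq J x, ← integral_const_mul]
    refine integral_mono hi3 (hi2.const_mul S) fun θ => ?_
    dsimp only
    rw [← mul_assoc]
    exact mul_le_mul_of_nonneg_right (G.sq_sum_siteCharge_imChar_le hJ x θ) (hwpos θ).le
  -- Step 2: `Im² = 1 − Re² ≤ 2(1 − Re)` pointwise, integrated: `∫ (∑ J k² Im²) w ≤ 2 (S Z − E)`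
  have h2 : ∫ θ, (∑ a, J a * G.siteCharge x a ^ 2 * imChar (G.bondChar a) θ ^ 2) * w θ ∂torusHaar V ≤
      2 * (S * Z - E) := by
    have hpt : ∀ θ, (∑ a, J a * G.siteCharge x a ^ 2 * imChar (G.bondChar a) θ ^ 2) * w θ ≤
        ∑ a, 2 * (J a * G.siteCharge x a ^ 2) * (w θ - reChar (G.bondChar a) θ * w θ) := by
      intro θ
      rw [Finset.sum_mul]
      refine Finset.sum_le_sum fun a _ => ?_
      have hc := reChar_sq_add_imChar_sq (G.bondChar a) θ
      have hr1 : reChar (G.bondChar a) θ ≤ 1 := (le_abs_self _).trans (abs_reChar_le_one _ _)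
      have hck : 0 ≤ J a * G.siteCharge x a ^ 2 := mul_nonneg (hJ a) (sq_nonneg _)
      have hw0 := (hwpos θ).le
      have hkey : imChar (G.bondChar a) θ ^ 2 ≤ 2 * (1 - reChar (G.bondChar a) θ) := by nlinarith
      calc J a * G.siteCharge x a ^ 2 * imChar (G.bondChar a) θ ^ 2 * w θ
          = (J a * G.siteCharge x a ^ 2) * (imChar (G.bondChar a) θ ^ 2 * w θ) := by ring
        _ ≤ (J a * G.siteCharge x a ^ 2) * (2 * (1 - reChar (G.bondChar a) θ) * w θ) :=
            mul_le_mul_of_nonneg_left (mul_le_mul_of_nonneg_right hkey hw0) hck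
        _ = 2 * (J a * G.siteCharge x a ^ 2) * (w θ - reChar (G.bondChar a) θ * w θ) := by ring
    have hi5 : ∀ a ∈ (univ : Finset ι), Integrable (fun θ => 2 * (J a * G.siteCharge x a ^ 2) *
        (w θ - reChar (G.bondChar a) θ * w θ)) (torusHaar V) := fun a _ =>
      ((integrable_torusHaar_of_continuous hwc).sub (hi1 a)).const_mul _
    refine (integral_mono hi2 (integrable_finsetSum _ hi5) hpt).trans (le_of_eq ?_)
    rw [integral_finsetSum _ hi5]
    simp_rw [integral_const_mul, integral_sub (integrable_torusHaar_of_continuous hwc) (hi1 _)]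
    rw [hSdef, hEdef, siteCouplingSum, Finset.sum_mul, ← Finset.sum_sub_distrib, Finset.mul_sum]
    exact Finset.sum_congr rfl fun a _ => by rw [← hZdef]; ring
  -- combine: `E (1 + 2S) ≤ 2 S² Z`
  have h3 : E * (1 + 2 * S) ≤ 2 * S ^ 2 * Z := by
    have := h1.trans (mul_le_mul_of_nonneg_left h2 hS)
    nlinarith
  have h12S : 0 < 1 + 2 * S := by linarith
  rw [le_div_iff₀ h12S]
  have h4 : G.siteEnergy J x * (1 + 2 * S) * Z ≤ 2 * S ^ 2 * Z := by
    calc G.siteEnergy J x * (1 + 2 * S) * Z = E * (1 + 2 * S) := by rw [← hE]; ring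
      _ ≤ 2 * S ^ 2 * Z := h3
  exact le_of_mul_le_mul_right h4 hZ

/-- The local energy bound in the form `e_x ≤ S_x · (2S_x/(1 + 2S_x))`: the average energy of the
bonds at `x` (weights `J_a k_a²/S_x`) is at most `2S_x/(1 + 2S_x) < 1`.
[cite: AizenmanSimon1980LocalWard, eq. (2.4) with A = ∂H/∂θ_x (N = 2)] -/
theorem siteEnergy_le' {J : ι → ℝ} (hJ : ∀ a, 0 ≤ J a) (x : V) :
    G.siteEnergy J x ≤ G.siteCouplingSum J x * (2 * G.siteCouplingSum J x / (1 + 2 * G.siteCouplingSum J x)) := by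
  have h := G.siteEnergy_le hJ x
  have hS := G.siteCouplingSum_nonneg hJ x
  calc G.siteEnergy J x ≤ 2 * G.siteCouplingSum J x ^ 2 / (1 + 2 * G.siteCouplingSum J x) := h
    _ = _ := by rw [sq]; ring

end Equipartition

end BondSystem

end Literature.Probability.LatticeModels

end
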